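import Summits.BirchSwinnertonDyer.BirchSwinnertonDyer.Theorems.KatoDescentPotSupersingularIntegralH1RankZeroLevelwise
import Summits.BirchSwinnertonDyer.BirchSwinnertonDyer.Theorems.CongruentShaFreeCutIntegralH1RankLeOne
import Literature.NumberTheory.GaloisCohomology.ArchimedeanInvariantMap
import Literature.NumberTheory.EllipticCurves.WeilPairingProofs
import Literature.NumberTheory.EllipticCurves.PAdicBSDKatoFiniteProofs
import Literature.NumberTheory.EllipticCurves.Kato2004.IwasawaH2DescentFiniteSelmer
import Literature.NumberTheory.EllipticCurves.Kato2004.IwasawaH1ProjZeroKernelProofs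
import Literature.NumberTheory.EllipticCurves.Kato2004.IwasawaH1LambdaTorsionFreeProofs
import Mathlib.Topology.MetricSpace.Basic

set_option linter.dupNamespace false
set_option autoImplicit false

/-! # Crux M `ReducibleKatoMember` (stmt-BirchSwinnertonDyer-19196, routes `KatoDescentPotSupersingular` (K9) /
`KatoDescentTamePotSupersingular` (K8-t′)) — (R0) «`W(ℚ)` finite ∧ `Ш(W)[p^∞]` finite ⇒
`rank_{ℤ_p} H¹(ℤ[1/p], T_pW) ≤ 1» — the uniform LEVELWISE DICHOTOMY for the reductions of two integral
classes (part 2 of 3; part 1 = `…IntegralH1RankZeroLevelwise.lean`, part 3 = `…IntegralH1RankZero.lean`)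

Cell `bsd-potss`, prover seat `bsd-potss-rkm` g9.  Supports, does not close, stmt-BirchSwinnertonDyer-19196:
the clauses `finite_coinvariants_H2` (Thm. 14.5 (1) with (14.14.2)) and `index_ne_zero` (Thm. 14.5 (2)) of the
held input `Kato2004.exists_memberHullInputs` (item 19659) are statements about a rank-`0` curve at the bottom
layer; this file proves the arithmetic input they rest on, for EVERY elliptic curve over `ℚ` with finite
Mordell–Weil group and finite `Ш[p^∞]` and EVERY prime `p` (no reduction-type, image or parity hypothesis),
and derives the finiteness of Kato's descent cokernel `H¹(ℤ[1/p], T_pW) / proj₀(𝐇¹_Γ/T)` on every pin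
whose `𝐇¹_Γ` is non-zero.  Theorems only (no definition, no named fact, no `sorry`); route-free.

## Contents

* §4a **`exists_uniform_levelwise_dichotomy`**: if `W(ℚ)` and `Ш(W)[p^∞]` are finite there is ONE `M ≠ 0`
  such that for all integral `x, y ∈ H¹(Γ_ℚ, T_pW)` and every `k` there is an INTEGER `ℓ` with
  `red_{p^{k+1}}(M • y − ℓ • M • x) = 0` or `red_{p^{k+1}}(M • x − ℓ • M • y) = 0` (`M = B·m·T`: `T` puts
  integral classes in the Selmer conditions away from `p` (cn100's
  `exists_uniform_nsmul_reduction_mem_selmerLocalKer`), `m` and the local dichotomy of part 1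
  (`exists_zsmul_sub_mem_kummerSelmerStructure_or`, local Tate duality for `E` at `p`, with a Weil pairing
  `WeierstrassCurve.exists_weilPairing_holds` and the canonical local invariant map
  `LocalInvariants.canonical`, injective by `canonical_isPerfect`) put the difference in the condition AT `p`,
  and `B` kills the finite Selmer group (`exists_uniform_nsmul_eq_zero_of_mem_selmerGroup`)).  This replaces
  step (F1) of cell `bsd-cn100`'s rank-one proof (`CongruentShaFreeCutIntegralH1RankLeOne`, p508547); part 3
  runs their steps (F2)–(F5) verbatim on it.

HONEST FRAMING: Galois-cohomology bookkeeping over tree theorems; no named fact is introduced or discharged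
outright (the 2adic fact is reduced to `thm12_4`, whose rank-one clause is Kato's Euler-system theorem); nothing
about the zeta side of crux M (explicit reciprocity, `𝐇²` torsion, divisibility), the leaf or BSD is proved.
PARTITION (D-0054): types-the-object-of two clauses of held input 19659 of crux M (B5 O6 wild 3 × X3 reducible
rows + B4 (t′) X3 rows); closes NONE.

References: [Kato2004Asterisque] Thm. 14.5 (1) (p. 236), §14.9 (14.9.3) (p. 240), 14.13 and §14.14 (14.14.1)
(p. 243), Thm. 12.4 (p. 221); [MilneADT2006] I Cor. 2.3, Cor. 3.4, Lemma 6.15; [SilvermanAEC2009] VII.6.3,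
X.§4; [Rubin2000] App. B Prop. B.2.3; [BurungaleTian2026] proof of Thm. 3.1, (3.1). -/

noncomputable section

open scoped Classical NumberField

namespace Summit.BirchSwinnertonDyer.BirchSwinnertonDyer.Theorems.IntegralH1RankZero

open CategoryTheory Field IsDedekindDomain NumberField Function
open WeierstrassCurve (geomPoints geomTorsion galH1Torsion selmerLocalKer selmerGroup torsionPoints
  torsionGaloisModule kummerMapTorsion kummerMapTorsion_mem_selmerLocalKer)
open Literature.NumberTheory.GaloisRepresentations Literature.NumberTheory.GaloisCohomology
open Literature.NumberTheory.GaloisRepresentations.DiscreteGaloisModule (mu MuCarrier SelmerStructure)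
open Literature.NumberTheory.EllipticCurves Literature.NumberTheory.EllipticCurves.Kato2004
open Literature.NumberTheory.EllipticCurves.Kato2004.EulerSystemValues
open Literature.NumberTheory.EllipticCurves.IwasawaAlgebra
open Summit.BirchSwinnertonDyer.Rank1Residual
open Summit.BirchSwinnertonDyer.BirchSwinnertonDyer.Theorems.CongruentShaFreeCutIntegralH1RankLeOne
open Summit.BirchSwinnertonDyer.BirchSwinnertonDyer.Theorems.CongruentShaFreeCutSelmerRankOneLevelwise
open scoped ContRepresentation

/-! ## §4 (R0): `rank_{ℤ_p} H¹(ℤ[1/p], T_pW) ≤ 1` when `W(ℚ)` and `Ш[p^∞]` are finite -/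

section RankZero

variable (W : WeierstrassCurve ℚ) [W.IsElliptic] (p : ℕ) [Fact p.Prime]
  [ContinuousSMul ℤ_[p] (W.tateModule p)]

/-- **The levelwise dichotomy for the reductions of two integral classes** (rank zero).  If `W(ℚ)` and
`Ш(W)[p^∞]` are finite there is ONE `M ≠ 0` such that for all integral `x, y ∈ H¹(Γ_ℚ, T_pW)` and every `k`
there is an integer `ℓ` with `red_{p^{k+1}}(M • y − ℓ • M • x) = 0` or `red_{p^{k+1}}(M • x − ℓ • M • y) = 0`.
`M = B · m · T`: `T` (integral classes are Selmer away from `p`,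
`exists_uniform_nsmul_reduction_mem_selmerLocalKer`), `m` and `ℓ` (the local dichotomy at `p`,
`exists_zsmul_sub_mem_kummerSelmerStructure_or`, with the generator of `W(ℚ_p)` modulo `p^{k+1}`,
`exists_local_generator`), `B` (kills `Sel^{(p^{k+1})}(W/ℚ)`, `exists_uniform_nsmul_eq_zero_of_mem_selmerGroup`).
[cite: Kato2004Asterisque, 14.13 (p. 243) and §14.9 (14.9.3) (p. 240)] [cite: MilneADT2006, Ch. I, Cor. 3.4] -/
theorem exists_uniform_levelwise_dichotomy [Finite W.toAffine.Point]
    [Finite (AddCommGroup.primaryComponent W.sha p)] :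
    ∃ M : ℕ, M ≠ 0 ∧ ∀ (x y : H1 (tateRep W p) ⊤), x ∈ integralH1 (tateRep W p) p ⊤ →
      y ∈ integralH1 (tateRep W p) p ⊤ → ∀ k : ℕ, ∃ ℓ : ℤ,
        reduceH1Pk W p (k + 1) ⊤ (M • y - ℓ • (M • x)) = 0 ∨
          reduceH1Pk W p (k + 1) ⊤ (M • x - ℓ • (M • y)) = 0 := by
  have hp : p.Prime := Fact.out
  obtain ⟨T, hT0, hT⟩ := exists_uniform_nsmul_reduction_mem_selmerLocalKer W p
  obtain ⟨B, hB0, hB⟩ := exists_uniform_nsmul_eq_zero_of_mem_selmerGroup W p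
  obtain ⟨P₀, m, hm0, hgen⟩ := exists_local_generator W p
  refine ⟨B * (m * T), Nat.mul_ne_zero hB0 (Nat.mul_ne_zero hm0 hT0), fun x y hx hy k => ?_⟩
  -- the level `N = p^{k+1}` as a natural number, and the cast bookkeeping
  set N : ℕ := p ^ (k + 1) with hN
  haveI : NeZero N := ⟨pow_ne_zero _ hp.ne_zero⟩
  have hNprime : IsPrimePow N := (hp.isPrimePow).pow (Nat.succ_ne_zero k)
  have hcast : ((p : ℤ) ^ (k + 1)) = (N : ℤ) := by rw [hN]; push_cast; rfl
  -- the canonical local invariant map at `v = (p)` is injective (local Tate duality, `canonical_isPerfect`)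
  have hinv : Injective (LocalInvariants.canonical ℚ N (Sum.inr (primePlace p))) :=
    ((LocalInvariants.canonical_isPerfect (K := ℚ) (n := N)) (primePlace p)).1.1
  -- the generator of `W(ℚ_v)` modulo `N`
  have hgenN : ∀ P : (W.baseChange ((primePlace p).adicCompletion ℚ)).toAffine.Point,
      ∃ (ℓ : ℤ) (Q : (W.baseChange ((primePlace p).adicCompletion ℚ)).toAffine.Point),
        m • P = ℓ • P₀ + (N : ℤ) • Q := by
    intro P
    obtain ⟨ℓ, Q, h⟩ := hgen (k + 1) P
    exact ⟨ℓ, Q, by rw [← hcast]; exact h⟩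
  -- the level-`N` statement, for classes of `H¹(ℚ, W[n])` with `n = N` (the level indexes the types)
  have key : ∀ (n : ℤ), n = (N : ℤ) → ∀ c d : galH1Torsion W n,
      (∀ v' : HeightOneSpectrum (𝓞 ℚ), v' ≠ primePlace p →
        T • c ∈ selmerLocalKer W (v'.adicCompletion ℚ) n) →
      (∀ w : InfinitePlace ℚ, T • c ∈ selmerLocalKer W w.Completion n) →
      (∀ v' : HeightOneSpectrum (𝓞 ℚ), v' ≠ primePlace p →
        T • d ∈ selmerLocalKer W (v'.adicCompletion ℚ) n) →
      (∀ w : InfinitePlace ℚ, T • d ∈ selmerLocalKer W w.Completion n) →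
      ∃ ℓ : ℤ, (B * (m * T)) • d - ℓ • ((B * (m * T)) • c) = 0 ∨
        (B * (m * T)) • c - ℓ • ((B * (m * T)) • d) = 0 := by
    rintro n rfl c d hc1 hc2 hd1 hd2
    -- localise at `v = (p)` and apply the local dichotomy to `loc (T • c)`, `loc (T • d)`
    let loc : galH1Torsion W (N : ℤ) →+
        galoisCohomology ((W.torsionGaloisModule (N : ℤ)).toLocal (Sum.inr (primePlace p) : Place ℚ)) 1 :=
      galoisCohomology.localization (W.torsionGaloisModule (N : ℤ)) (Sum.inr (primePlace p) : Place ℚ) 1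
    obtain ⟨ℓ, hℓ⟩ := exists_zsmul_sub_mem_kummerSelmerStructure_or W N hNprime (primePlace p)
      (LocalInvariants.canonical ℚ N (Sum.inr (primePlace p))) hinv P₀ hgenN (loc (T • c)) (loc (T • d))
    -- Selmer assembly: `m • (T•w − ℓ•T•u) ∈ Sel^{(N)}` when its localisation at `(p)` is in `𝓛_p`
    have assemble : ∀ (u w : galH1Torsion W (N : ℤ)),
        (∀ v' : HeightOneSpectrum (𝓞 ℚ), v' ≠ primePlace p →
          T • u ∈ selmerLocalKer W (v'.adicCompletion ℚ) (N : ℤ)) →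
        (∀ w' : InfinitePlace ℚ, T • u ∈ selmerLocalKer W w'.Completion (N : ℤ)) →
        (∀ v' : HeightOneSpectrum (𝓞 ℚ), v' ≠ primePlace p →
          T • w ∈ selmerLocalKer W (v'.adicCompletion ℚ) (N : ℤ)) →
        (∀ w' : InfinitePlace ℚ, T • w ∈ selmerLocalKer W w'.Completion (N : ℤ)) →
        m • (loc (T • w) - ℓ • loc (T • u)) ∈ W.kummerSelmerStructure N (Sum.inr (primePlace p)) →
        (B * (m * T)) • w - ℓ • ((B * (m * T)) • u) = 0 := by
      intro u w hu1 hu2 hw1 hw2 hlocal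
      have hlocal' : loc (m • (T • w - ℓ • (T • u))) ∈ W.kummerSelmerStructure N (Sum.inr (primePlace p)) := by
        rw [map_nsmul, map_sub, map_zsmul]
        exact hlocal
      have hsel : m • (T • w - ℓ • (T • u)) ∈ selmerGroup W (N : ℤ) := by
        rw [WeierstrassCurve.mem_selmerGroup_iff]
        refine ⟨fun v' => ?_, fun w' => ?_⟩
        · by_cases hv' : v' = primePlace p
          · subst hv'
            rw [← WeierstrassCurve.selmerLocalKer_completion_inr,
              ← WeierstrassCurve.comap_localization_kummerSelmerStructure]
            exact hlocal'
          · exact AddSubgroup.nsmul_mem _ (AddSubgroup.sub_mem _ (hw1 v' hv')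
              (AddSubgroup.zsmul_mem _ (hu1 v' hv') ℓ)) m
        · exact AddSubgroup.nsmul_mem _ (AddSubgroup.sub_mem _ (hw2 w')
            (AddSubgroup.zsmul_mem _ (hu2 w') ℓ)) m
      have hkill := hB (N : ℤ) ⟨k + 1, hcast.symm⟩ _ hsel
      -- `(B m T) • w − ℓ • (B m T) • u = B • (m • (T • w − ℓ • T • u))`
      have e : (B * (m * T)) • w - ℓ • ((B * (m * T)) • u) = B • (m • (T • w - ℓ • (T • u))) := by
        rw [smul_sub, smul_sub, mul_nsmul', mul_nsmul', mul_nsmul', mul_nsmul', smul_comm ℓ B, smul_comm ℓ m]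
      rw [e, hkill]
    rcases hℓ with h | h
    · exact ⟨ℓ, Or.inl (assemble c d hc1 hc2 hd1 hd2 h)⟩
    · exact ⟨ℓ, Or.inr (assemble d c hd1 hd2 hc1 hc2 h)⟩
  -- apply at level `(p : ℤ)^(k+1)` to the reductions of `x`, `y`
  obtain ⟨hx1, hx2⟩ := hT x hx (k + 1)
  obtain ⟨hy1, hy2⟩ := hT y hy (k + 1)
  obtain ⟨ℓ, hℓ⟩ := key _ hcast _ _ hx1 hx2 hy1 hy2
  refine ⟨ℓ, ?_⟩
  have red : ∀ (u w : H1 (tateRep W p) ⊤),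
      (B * (m * T)) • (ofTopSubgroup (W.torsionGaloisModule ((p : ℤ) ^ (k + 1))).toTopRep 1).hom
          (reduceH1Pk W p (k + 1) ⊤ w) -
        ℓ • ((B * (m * T)) • (ofTopSubgroup (W.torsionGaloisModule ((p : ℤ) ^ (k + 1))).toTopRep 1).hom
          (reduceH1Pk W p (k + 1) ⊤ u)) = 0 →
      reduceH1Pk W p (k + 1) ⊤ ((B * (m * T)) • w - ℓ • ((B * (m * T)) • u)) = 0 := by
    intro u w h
    apply eq_zero_of_ofTopSubgroup_eq_zero
    rw [map_sub, map_zsmul, map_nsmul, map_nsmul, map_sub, map_zsmul, map_nsmul, map_nsmul]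
    exact h
  rcases hℓ with h | h
  · exact Or.inl (red x y h)
  · exact Or.inr (red y x h)

end RankZero

end Summit.BirchSwinnertonDyer.BirchSwinnertonDyer.Theorems.IntegralH1RankZero

end
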